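import Summits.BirchSwinnertonDyer.BirchSwinnertonDyer.Theorems.ManinLocalTwoThreePinningTwoFiftyTwoStagesC
import HarnessLib

/-!
# Level 252 by the PINNING KERNEL IN `S₂` — staged sieve certificates (part 13 of 18)

Cell `bsd-f2-manin`, route `ManinLocalTwoThree`, crux C2 `ManinOddAtFour` (stmt-BirchSwinnertonDyer-22967), an g57 (pipeline of an g56);
`--supports stmt-BirchSwinnertonDyer-22967` (helper).  The kernel certificates `hst4c15` … `hst4c19` (stage 4) of the staged box sieve
of level 252 (stage `k` maps the live list `L_k` of `…PinningTwoFiftyTwoTables` into `L_{k+1}`; large stages in chunks of at most `EXTCAP = 160` extensions (`3·EXTCAP/(4·r)` at a stage with `r ≥ 2` relations),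
glued by part D's `sieveStep_subset_of_chunks`), split off the main file so that every file stays inside the farm's per-file
budget (depth `K = 192`: at `2²·3² ∣ N` every column with `(n, 6) > 1` is dead and the certified column relations only begin at `p = 13` (column `175 = 5²·7`; then three at `p = 11`, two at `p = 17`), so the sieve needs depth `192` and carries `1485 + 975 + 153` extensions through its last three stages at a measured ≈ 0.8 / 0.55 / 0.5 s of kernel time each, in `25 + 38 + 5` chunks over eight files).  Next = `…PinningTwoFiftyTwoStagesE`; the last part `…PinningTwoFiftyTwo` has the duals, the cover `hcover` (from `hst0 … hst6`), the Fricke sieve, `dim S₂` and the pinning theorems.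
HONEST FRAMING: kernel-checked evaluations of integer lists only; nothing here proves C2/C3, Manin's conjecture or BSD.
[cite: CremonaAlgorithms1997, §2.10] [cite: Koehler2011, §2.1]
-/


set_option autoImplicit false
-- lint-debt: the directory name repeats the summit name (sibling precedent `ManinLocalTwoThreePinningSixtyThree.lean`)
set_option linter.dupNamespace false

noncomputable section


open Complex
open UpperHalfPlane hiding I
open scoped MatrixGroups ModularForm
open ModularForm CongruenceSubgroup
open Literature.NumberTheory.ModularForms
open Literature.NumberTheory.EllipticCurves Literature.NumberTheory.EllipticCurves.ModularForms

namespace Summit.BirchSwinnertonDyer.BirchSwinnertonDyer.Theorems.ManinLocalTwoThree.PinningTwoFiftyTwo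

open Summit.BirchSwinnertonDyer.BirchSwinnertonDyer.Theorems.ManinLocalTwoThree.BracketSturm
open Summit.BirchSwinnertonDyer.BirchSwinnertonDyer.Theorems.ManinLocalTwoThree.PinningKernel


set_option maxHeartbeats 4000000
set_option maxRecDepth 16384

/-! ## §2d-4 Sieve certificates `hst4c15` … `hst4c19` (stage 4) -/

/-- Sieve stage `4`, chunk `15` (kernel `decide`). [folklore] -/
theorem hst4c15 : ∀ σ ∈ sieveStep 252 192 (chunks4.getD 15 []) (stages.getD 4 (0, [])), σ ∈ lvs.getD 4 [] := by decide +kernel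
/-- Sieve stage `4`, chunk `16` (kernel `decide`). [folklore] -/
theorem hst4c16 : ∀ σ ∈ sieveStep 252 192 (chunks4.getD 16 []) (stages.getD 4 (0, [])), σ ∈ lvs.getD 4 [] := by decide +kernel
/-- Sieve stage `4`, chunk `17` (kernel `decide`). [folklore] -/
theorem hst4c17 : ∀ σ ∈ sieveStep 252 192 (chunks4.getD 17 []) (stages.getD 4 (0, [])), σ ∈ lvs.getD 4 [] := by decide +kernel
/-- Sieve stage `4`, chunk `18` (kernel `decide`). [folklore] -/
theorem hst4c18 : ∀ σ ∈ sieveStep 252 192 (chunks4.getD 18 []) (stages.getD 4 (0, [])), σ ∈ lvs.getD 4 [] := by decide +kernel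
/-- Sieve stage `4`, chunk `19` (kernel `decide`). [folklore] -/
theorem hst4c19 : ∀ σ ∈ sieveStep 252 192 (chunks4.getD 19 []) (stages.getD 4 (0, [])), σ ∈ lvs.getD 4 [] := by decide +kernel

end Summit.BirchSwinnertonDyer.BirchSwinnertonDyer.Theorems.ManinLocalTwoThree.PinningTwoFiftyTwo

end
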